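import Summits.BirchSwinnertonDyer.BirchSwinnertonDyer.Theorems.AdditiveBranchIMCGordTwoTwistedPartnerTransport
import Summits.BirchSwinnertonDyer.BirchSwinnertonDyer.Theorems.AdditiveBranchIMCGordTwoTwistedReciprocityAnyTwo
import Summits.BirchSwinnertonDyer.BirchSwinnertonDyer.Theorems.AdditiveBranchIMCGordTwoTwistedAuxSign
import Summits.BirchSwinnertonDyer.BirchSwinnertonDyer.Theorems.AdditiveBranchIMCTwistRootNumberTwistedKroneckerAnyTwo
import Summits.BirchSwinnertonDyer.BirchSwinnertonDyer.Theorems.AdditiveBranchIMCTwistRootNumberTwistedClass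
import Summits.BirchSwinnertonDyer.BirchSwinnertonDyer.Theorems.AdditiveBranchIMCTwistTypeConductorAtThree
import Summits.BirchSwinnertonDyer.BirchSwinnertonDyer.Theorems.AdditiveBranchIMCGordTwoRankZeroOffCaseOneFieldSupplyTwoR0Aux
import Summits.BirchSwinnertonDyer.Rank1Residual.AdditivePotMult.QuadraticTwistTamagawaMultiplicative
import Literature.NumberTheory.EllipticCurves.BSDSelmerSkinnerThmBProofs
import Literature.NumberTheory.QuadraticFields.KroneckerSplitting
import HarnessLib

/-!
# FieldTwoTwisted, design D2, STAGE 1 (Aux″) FOR ANY TWIST-TYPE REDUCTION AT `2`: the auxiliary twist `X′ ≅ V^{(d_K ℓ₀*)}` of root number `−1`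
# (crux 19357, line `three_field_road`, door A2 «additive `2` on E3′ rows»; LEAD g18, sibling of `exists_auxTwist_twisted_kronecker` p812916)

Theorems only. `exists_auxTwist_twisted_kronecker` (LEAD g17) VERBATIM with its binder «`E` not additive at `2`» REPLACED by the sub-row's dyadic
twist-type clause: the partner `V` (`E ≅ V^{(p*)}`) inherits the clause (`f₂` is not moved by the twist `p* ≡ 1 (mod 4)`), the sign is computed by the
any-two Kronecker engine (`rootNumber_quadraticTwist_eq_of_potMult_kronecker_anyTwo`, p816093: factor `1` at an additive `2`), and the reciprocity
identity is `prod_engineKronecker_eq_jacobiSym_even` (p-next: `f₂(V) ∈ {4, 6}` is EVEN at an additive twist-type `2`). Same data out.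

* `exists_auxTwist_twisted_kronecker_anyTwo`.

BSD is proved for no curve. References: [SilvermanAEC2009] X.5 Cor. 5.4, Ex. 10.16, App. A, App. C §16; [IrelandRosen1990] Ch. 5 §2, Ch. 16 §1;
[AtkinLi1978] §3; [Rohrlich1993Compositio] Prop. 2–3; [BarriosEtAl2025] Thm. 5.1.
-/


set_option linter.dupNamespace false
set_option autoImplicit false

noncomputable section

open scoped Classical

open WeierstrassCurve IsDedekindDomain IsDedekindDomain.HeightOneSpectrum NumberField Rat.HeightOneSpectrum
  Literature.NumberTheory.EllipticCurves Literature.NumberTheory.EllipticCurves.ModularForms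
  Literature.NumberTheory.EllipticCurves.Rank1Residual Literature.NumberTheory.QuadraticFields
  Summit.BirchSwinnertonDyer.Rank1Residual Summit.BirchSwinnertonDyer.Rank1Residual.Additive
  Summit.BirchSwinnertonDyer.BirchSwinnertonDyer.Theorems

namespace Summit.BirchSwinnertonDyer.BirchSwinnertonDyer.Theorems.TwistedWanRoad

open NumberTheorySymbols
open Summit.BirchSwinnertonDyer.BirchSwinnertonDyer.Theorems.AdditiveKoly.RamifiedHabitat (pStar_emod_four eq_of_prime_dvd_pStar)
open Summit.BirchSwinnertonDyer.BirchSwinnertonDyer.Theorems.ThreeFieldRoadSupply (exists_goodOrd_partner_rootNumber genusFactor_spec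
  discr_emod_eight_of_two_split jacobiSym_mul_self_eq_one natAbs_pStar squarefree_pStar)

/-! ### §2 The auxiliary twist -/

section Aux

variable (W : WeierstrassCurve ℚ) [W.IsElliptic] [W.IsGloballyMinimal] (p : ℕ) [hp : Fact p.Prime]
  {q : ℕ} [hq : Fact q.Prime] (K : Type) [Field K] [NumberField K]

/-- **FieldTwoTwisted (design D2), Stage 1 — the auxiliary twist of root number `−1` on the twisted Wan road, any twist-type `2`.**
For `(E, p)` on the (G-ord, `e = 2`) cell with `p ≥ 5`, `w(E) = +1`, every odd additive prime of twist type, `2` of twist type if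
additive (NO condition on `p` mod `8`), and a twisted road field `K` at the twisted Wan prime `q`: the partner `V` (`E ≅ V^{(p*)}`,
`N_E = N_V p²`, good ordinary at `p`), the genus factor `δ` (`d_K = q* δ`), a prime `ℓ₀ ∉ {2, p, q}`, `ℓ₀ ∤ N_E M₀ δ`, with
`p* ℓ₀* > 0`, `d_K p* ℓ₀* ≡ 1 (mod 8)` (so `p* ℓ₀* ≡ 1 (mod 8)`), `(ℓ₀*/r) = (p*/r)` at the odd primes `r ≠ p` of
`N_E M₀`, `(ℓ₀*/p) = (d_K/p) = 1`, and a globally minimal `X ≅ V^{(d_K ℓ₀*)}` with `w(X) = −1` (Kronecker engine).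
[cite: SilvermanAEC2009, X.5 Cor. 5.4 and Ex. 10.16] [cite: IrelandRosen1990, Ch. 16 §1] -/
theorem exists_auxTwist_twisted_kronecker_anyTwo
    (hmod : exists_isNewformOf) (hp5 : 5 ≤ p) (hw : W.rootNumber = 1) (hcell : N10.CellGordTwo W p)
    (htt : ∀ r : Nat.Primes, (r : ℕ) ≠ 2 → W.HasAdditiveReductionAt ((primesEquiv (R := ℤ)).symm r) →
      ¬ (W.quadraticTwist (((-1 : ℤ) ^ ((r : ℕ) / 2) * r : ℤ) : ℚ)).HasAdditiveReductionAt ((primesEquiv (R := ℤ)).symm r))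
    (h2tt : ∀ r : Nat.Primes, (r : ℕ) = 2 → W.HasAdditiveReductionAt ((primesEquiv (R := ℤ)).symm r) →
      ∃ t : ℤ, (t = -1 ∨ t = 2 ∨ t = -2) ∧ ¬ (W.quadraticTwist (t : ℚ)).HasAdditiveReductionAt ((primesEquiv (R := ℤ)).symm r))
    (hK : TameRoadFieldTwisted W p q K) (M₀ : ℕ) (hM₀ : M₀ ≠ 0) :
    ∃ (V : WeierstrassCurve ℚ) (_ : V.IsElliptic) (_ : V.IsGloballyMinimal) (C' : VariableChange ℚ)
      (δ : ℤ) (ℓ₀ : ℕ) (X : WeierstrassCurve ℚ) (_ : X.IsElliptic) (_ : X.IsGloballyMinimal) (CX : VariableChange ℚ),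
      C' • V.quadraticTwist ((-1 : ℚ) ^ (p / 2) * p) = W ∧ GoodOrd V p ∧
      W.conductorNorm ℤ = V.conductorNorm ℤ * p ^ 2 ∧
      NumberField.discr K = ((-1 : ℤ) ^ (q / 2) * q) * δ ∧ Squarefree δ ∧ ¬ (p : ℤ) ∣ δ ∧ ¬ (q : ℤ) ∣ δ ∧ δ ≠ 0 ∧
      ℓ₀.Prime ∧ ℓ₀ ≠ p ∧ ℓ₀ ≠ q ∧ ℓ₀ ≠ 2 ∧ ¬ ℓ₀ ∣ W.conductorNorm ℤ * M₀ ∧ ¬ (ℓ₀ : ℤ) ∣ δ ∧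
      0 < ((-1 : ℤ) ^ (p / 2) * p) * ((-1 : ℤ) ^ (ℓ₀ / 2) * ℓ₀) ∧
      (NumberField.discr K * ((-1 : ℤ) ^ (p / 2) * p) * ((-1 : ℤ) ^ (ℓ₀ / 2) * ℓ₀)) % 8 = 1 ∧
      (2 ∣ W.conductorNorm ℤ → (((-1 : ℤ) ^ (p / 2) * p) * ((-1 : ℤ) ^ (ℓ₀ / 2) * ℓ₀)) % 8 = 1) ∧
      (∀ r : ℕ, r.Prime → r ∣ W.conductorNorm ℤ * M₀ → r ≠ 2 → r ≠ p →
        J((-1 : ℤ) ^ (ℓ₀ / 2) * ℓ₀ | r) = J((-1 : ℤ) ^ (p / 2) * p | r)) ∧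
      J((-1 : ℤ) ^ (ℓ₀ / 2) * ℓ₀ | p) = 1 ∧ J(NumberField.discr K | p) = 1 ∧
      CX • X = V.quadraticTwist (((NumberField.discr K * ((-1 : ℤ) ^ (ℓ₀ / 2) * ℓ₀)) : ℤ) : ℚ) ∧
      X.rootNumber = -1 := by
  obtain ⟨hKiq, -, htw, hcls, hsplit, h2split, -⟩ := hK
  have htw' := htw
  obtain ⟨hqp, hq2, haddq, hmultq, -⟩ := htw'
  have hpq : p ≠ q := fun h ↦ hqp h.symm
  have hp2 : p ≠ 2 := by omega
  have hpodd : p % 2 = 1 := hp.out.eq_two_or_odd.resolve_left hp2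
  -- notation
  set ps : ℤ := (-1 : ℤ) ^ (p / 2) * p with hps
  set qs : ℤ := (-1 : ℤ) ^ (q / 2) * q with hqs
  set dK : ℤ := NumberField.discr K with hdK
  have hdK0 : dK ≠ 0 := NumberField.discr_ne_zero K
  have hdKq : (dK : ℚ) ≠ 0 := by exact_mod_cast hdK0
  have hdKneg : dK < 0 := hKiq.discr_neg
  have hps0 : ps ≠ 0 := mul_ne_zero (pow_ne_zero _ (by norm_num)) (by exact_mod_cast hp.out.ne_zero)
  -- `2` splits in `K` (it is a bad prime `≠ q`, or `2 ∤ N_E`)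
  have h2K : ((Ideal.span {(2 : ℤ)}).primesOver (𝓞 K)).ncard = 2 := by
    by_cases h2N : 2 ∣ W.conductorNorm ℤ
    · exact hsplit 2 Nat.prime_two h2N (Ne.symm hq2)
    · exact h2split h2N
  obtain ⟨hdK8, hdK4, -, -⟩ := discr_emod_eight_of_two_split K hKiq h2K
  have hpN : p ∣ W.conductorNorm ℤ :=
    (W.dvd_conductorNorm_iff_not_hasGoodReductionAtPrime p).mpr hcell.2.1.1
  have hNW0 : W.conductorNorm ℤ ≠ 0 := (W.conductorNorm_pos_holds).ne'
  have hqd : (q : ℤ) ∣ dK := hcls.1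
  have hqN : q ∣ W.conductorNorm ℤ := by
    by_contra hqN
    have hg := ((W.hasGoodReductionAtPrime_iff_hasGoodReductionAt_holds) ⟨q, hq.out⟩).mp
      (by by_contra hng; exact hqN ((W.dvd_conductorNorm_iff_not_hasGoodReductionAtPrime q).mpr hng))
    exact haddq.not_hasGoodReductionAt hg
  -- §a the good-ordinary partner `V`
  obtain ⟨V, iV, iVm, CV, hCV, hordV, ⟨C', hC'⟩, hNWV, hpNV, hrootW⟩ :=
    exists_goodOrd_partner_rootNumber W p hmod hp5 hcell
  have hNV0 : V.conductorNorm ℤ ≠ 0 := (V.conductorNorm_pos_holds).ne'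
  have hNVW : V.conductorNorm ℤ ∣ W.conductorNorm ℤ := ⟨p ^ 2, hNWV⟩
  -- local data of `V`
  have haddVq : V.HasAdditiveReductionAt ((primesEquiv (R := ℤ)).symm ⟨q, hq.out⟩) :=
    (hasAdditiveReductionAt_iff_of_partner V W p hNWV ⟨q, hq.out⟩ hqp).mp haddq
  have hqs0 : ((-1 : ℤ) ^ (q / 2) * q : ℤ) ≠ 0 := mul_ne_zero (pow_ne_zero _ (by norm_num)) (by exact_mod_cast hq.out.ne_zero)
  have hmultVq : (V.quadraticTwist (((-1 : ℤ) ^ (q / 2) * q : ℤ) : ℚ)).HasMultiplicativeReductionAtPrime q := by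
    have h := hmultq
    rw [primeStar_eq] at h
    exact (hasMultiplicativeReductionAtPrime_quadraticTwist_iff_of_partner V W p hCV hp2 hqs0 hqp).mp h
  -- the dyadic twist-type clause transports to the partner (`p* ≡ 1 (mod 4)` does not move `f₂`)
  have h2ttV : ∀ r : Nat.Primes, (r : ℕ) = 2 → V.HasAdditiveReductionAt ((primesEquiv (R := ℤ)).symm r) →
      ∃ t : ℤ, (t = -1 ∨ t = 2 ∨ t = -2) ∧ ¬ (V.quadraticTwist (t : ℚ)).HasAdditiveReductionAt ((primesEquiv (R := ℤ)).symm r) := by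
    intro r hr2 haddV
    have hrp : (r : ℕ) ≠ p := by rw [hr2]; exact Ne.symm hp2
    have haddW := (hasAdditiveReductionAt_iff_of_partner V W p hNWV r hrp).mpr haddV
    obtain ⟨t, ht, hnt⟩ := h2tt r hr2 haddW
    have ht0 : t ≠ 0 := by rcases ht with rfl | rfl | rfl <;> norm_num
    exact ⟨t, ht, fun h ↦ hnt ((hasAdditiveReductionAt_quadraticTwist_iff_of_partner V W p hCV hp2 ht0 r hrp).mpr h)⟩
  have httV := twistType_of_partner V W p hNWV hCV hp2 hpNV htt
  -- §b the genus factor `δ`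
  obtain ⟨hfac, hδ4, hδsq, hqδ, hpδ, hδgood⟩ :=
    genusFactor_spec (p := p) (q := q) W K hKiq h2K hq2 hqd hsplit hpN hpq
  set δ : ℤ := dK / qs with hδ
  rw [← hdK] at hfac hdK8 hdK4
  clear_value δ dK
  have hδ0 : δ ≠ 0 := by rintro h; rw [h, mul_zero] at hfac; exact hdK0 hfac
  -- §c the free prime `ℓ₀` (plain `obtain`s, not `set`: abstracting `(-1)^(·/2)`-patterns over this context is too expensive)
  obtain ⟨σ, hσ⟩ : ∃ σ : ℤ, σ = (-1 : ℤ) ^ (p / 2) := ⟨_, rfl⟩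
  have hσ1 : σ = 1 ∨ σ = -1 := by rw [hσ]; exact neg_one_pow_eq_or ℤ (p / 2)
  obtain ⟨M, hM⟩ : ∃ M : ℕ, M = W.conductorNorm ℤ * M₀ := ⟨_, rfl⟩
  have hM0 : M ≠ 0 := by rw [hM]; exact mul_ne_zero hNW0 hM₀
  have hNM : W.conductorNorm ℤ ∣ M := by rw [hM]; exact dvd_mul_right _ _
  obtain ⟨Scrt, hScrt⟩ : ∃ S : Finset ℕ, S = M.primeFactors.erase 2 := ⟨_, rfl⟩
  have hScrt_mem : ∀ ℓ, ℓ ∈ Scrt ↔ ℓ.Prime ∧ ℓ ∣ M ∧ ℓ ≠ 2 := fun ℓ ↦ by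
    rw [hScrt, Finset.mem_erase, Nat.mem_primeFactors]
    exact ⟨fun ⟨h2, hP, hd, _⟩ ↦ ⟨hP, hd, h2⟩, fun ⟨hP, hd, h2⟩ ↦ ⟨h2, hP, hd, hM0⟩⟩
  obtain ⟨η, hη⟩ : ∃ η : ℕ → ℤ, η = fun ℓ ↦ if ℓ = p then 1 else J(ps | ℓ) := ⟨_, rfl⟩
  have hη1 : ∀ ℓ ∈ Scrt, η ℓ = 1 ∨ η ℓ = -1 := by
    intro ℓ hℓ
    obtain ⟨hℓp, -, -⟩ := (hScrt_mem ℓ).mp hℓ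
    simp only [hη]
    split_ifs with h1
    · exact Or.inl rfl
    · rcases jacobiSym.trichotomy ps ℓ with h0 | h0 | h0
      · exfalso
        have := jacobiSym_mul_self_eq_one hℓp (fun hd ↦ h1 (eq_of_prime_dvd_pStar (p := p) hℓp hd))
        rw [h0, mul_zero] at this
        exact zero_ne_one this
      · exact Or.inl h0
      · exact Or.inr h0
  obtain ⟨B, hB⟩ : ∃ B : ℕ, B = M * dK.natAbs := ⟨_, rfl⟩
  have hps4 : ps % 4 = 1 := by rw [hps]; exact pStar_emod_four (p := p) hp2
  have hm4 : (dK * ps) % 4 = 1 := by rw [Int.mul_emod, hdK4, hps4]; decide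
  obtain ⟨ℓ₀, hℓ₀, hBℓ₀, hσℓ₀, h8ℓ₀, hJℓ₀⟩ := WanAnyRoad.exists_prime_star_prescribed_of_emod_four hm4 hσ1
    Scrt (fun ℓ hℓ ↦ ⟨((hScrt_mem ℓ).mp hℓ).1, ((hScrt_mem ℓ).mp hℓ).2.2⟩) η hη1 B
  have hσp : (-1 : ℤ) ^ (ℓ₀ / 2) = (-1 : ℤ) ^ (p / 2) := hσℓ₀.trans hσ
  obtain ⟨ls, hls⟩ : ∃ ls : ℤ, ls = (-1 : ℤ) ^ (ℓ₀ / 2) * ℓ₀ := ⟨_, rfl⟩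
  -- `ℓ₀` is large: it divides neither `M = N_E M₀` nor `d_K`, and `ℓ₀ ∉ {2, p, q}`
  have hMB : M ≤ B := by rw [hB]; exact Nat.le_mul_of_pos_right M (Nat.pos_of_ne_zero (Int.natAbs_ne_zero.mpr hdK0))
  have hdB : dK.natAbs ≤ B := by rw [hB]; exact Nat.le_mul_of_pos_left _ (Nat.pos_of_ne_zero hM0)
  have hℓ₀M : ¬ ℓ₀ ∣ M := fun h ↦ by
    have := Nat.le_of_dvd (Nat.pos_of_ne_zero hM0) h
    omega
  have hℓ₀dK : ¬ (ℓ₀ : ℤ) ∣ dK := fun h ↦ by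
    have h' : ℓ₀ ∣ dK.natAbs := by simpa using Int.natAbs_dvd_natAbs.mpr h
    have := Nat.le_of_dvd (Nat.pos_of_ne_zero (Int.natAbs_ne_zero.mpr hdK0)) h'
    omega
  have hℓ₀NW : ¬ ℓ₀ ∣ W.conductorNorm ℤ := fun h ↦ hℓ₀M (h.trans hNM)
  have hℓ₀NM₀ : ¬ ℓ₀ ∣ W.conductorNorm ℤ * M₀ := by rw [← hM]; exact hℓ₀M
  have hℓ₀p : ℓ₀ ≠ p := fun h ↦ hℓ₀NW (h ▸ hpN)
  have hℓ₀q : ℓ₀ ≠ q := fun h ↦ hℓ₀dK (by rw [h]; exact hqd)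
  have hℓ₀δ : ¬ (ℓ₀ : ℤ) ∣ δ := fun h ↦ hℓ₀dK (h.trans ⟨qs, by rw [mul_comm]; exact hfac⟩)
  have hodd8 : ¬ (2 : ℤ) ∣ dK * ps * ((-1 : ℤ) ^ (ℓ₀ / 2) * ℓ₀) := fun ⟨k, hk⟩ ↦ by rw [hk] at h8ℓ₀; omega
  have hℓ₀2 : ℓ₀ ≠ 2 := by
    rintro rfl
    exact hodd8 ⟨dK * ps * (-1 : ℤ) ^ (2 / 2), by push_cast; ring⟩
  have hls4' : ((-1 : ℤ) ^ (ℓ₀ / 2) * ℓ₀) % 4 = 1 := (haveI := Fact.mk hℓ₀; pStar_emod_four (p := ℓ₀) hℓ₀2)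
  have hls4 : ls % 4 = 1 := by rw [hls]; exact hls4'
  have hls0 : ls ≠ 0 := by
    rw [hls]; exact mul_ne_zero (pow_ne_zero _ (by norm_num)) (by exact_mod_cast hℓ₀.ne_zero)
  have hJls : ∀ r : ℕ, r.Prime → r ∣ M → r ≠ 2 → r ≠ p → J(ls | r) = J(ps | r) := by
    intro r hr hrM hr2 hrp
    have := hJℓ₀ r ((hScrt_mem r).mpr ⟨hr, hrM, hr2⟩)
    simp only [hη, hrp, if_false] at this
    rw [hls]; exact this
  -- §d the twist parameter `D = d_K ℓ₀* = q* (δ ℓ₀*)`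
  obtain ⟨T, hT⟩ : ∃ T : ℤ, T = δ * ls := ⟨_, rfl⟩
  obtain ⟨D, hD⟩ : ∃ D : ℤ, D = dK * ls := ⟨_, rfl⟩
  have hDm : D = (-1 : ℤ) ^ (q / 2) * q * T := by rw [hD, hT, hfac]; ring
  have hD4 : D % 4 = 1 := by rw [hD, Int.mul_emod, hdK4, hls4]; decide
  have hpsls : (ps * ls) % 8 = 1 := by
    have e : (dK * (ps * ls)) % 8 = 1 := by rw [← mul_assoc, hls]; exact h8ℓ₀
    rw [Int.mul_emod, hdK8, one_mul, Int.emod_emod_of_dvd _ (dvd_refl (8 : ℤ))] at e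
    exact e
  have hT0 : T ≠ 0 := by rw [hT]; exact mul_ne_zero hδ0 hls0
  have hD0 : D ≠ 0 := by rw [hD]; exact mul_ne_zero hdK0 hls0
  have hDQ : (D : ℚ) ≠ 0 := by exact_mod_cast hD0
  have hTsq : Squarefree T := by
    rw [hT, squarefree_mul_iff]
    refine ⟨?_, hδsq, ?_⟩
    · refine (Int.isCoprime_iff_gcd_eq_one.mpr ?_).isRelPrime
      rw [Int.gcd_comm, Int.gcd_eq_natAbs, hls, natAbs_pStar]
      exact (Nat.Prime.coprime_iff_not_dvd hℓ₀).mpr fun h ↦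
        hℓ₀δ (Int.natAbs_dvd_natAbs.mp (by simpa using h))
    · rw [hls]; exact (haveI := Fact.mk hℓ₀; squarefree_pStar (p := ℓ₀))
  have hqls : ¬ (q : ℤ) ∣ ls := by
    rw [hls]; intro h
    exact hℓ₀q ((haveI := Fact.mk hℓ₀; eq_of_prime_dvd_pStar (p := ℓ₀) hq.out h)).symm
  have hqT : ¬ (q : ℤ) ∣ T := by
    rw [hT]; intro h
    rcases Int.Prime.dvd_mul' hq.out h with h | h
    · exact hqδ h
    · exact hqls h
  have hgoodV : ∀ r : Nat.Primes, ((r : ℕ) : ℤ) ∣ T → V.HasGoodReductionAt ((primesEquiv (R := ℤ)).symm r) := by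
    intro r hr
    rw [hT] at hr
    refine hasGoodReductionAt_of_partner_of_not_dvd V W p hNWV r ?_
    rcases Int.Prime.dvd_mul' r.2 hr with h | h
    · exact hδgood r r.2 h
    · rw [hls] at h
      have : (r : ℕ) = ℓ₀ := (haveI := Fact.mk hℓ₀; eq_of_prime_dvd_pStar (p := ℓ₀) r.2 h)
      rw [this]; exact hℓ₀NW
  -- §e `V^{(D)}` is NOT split at `q`: `V^{(D)} ≅ Wd^{(p* ℓ₀*)}`, `Wd` non-split at `q`, `p* ℓ₀*` a square mod `q`
  haveI := V.isElliptic_quadraticTwist hDQ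
  have hnsD : ¬ (V.quadraticTwist (D : ℚ)).HasSplitMultiplicativeReductionAtPrime q := by
    -- `Wd`
    obtain ⟨Wd, iWd, iWdm, Cd, hCd⟩ := exists_isGloballyMinimal_smul_eq_quadraticTwist W hdKq
    have hclass : legendreSym q (NumberField.discr K / ((-1 : ℤ) ^ (q / 2) * q)) =
        (if (W.quadraticTwist (((-1 : ℤ) ^ (q / 2) * q : ℤ) : ℚ)).HasSplitMultiplicativeReductionAtPrime q
          then -1 else 1) := by
      have h := hcls.2; rw [primeStar_eq] at h; exact h
    have hqd' : (q : ℤ) ∣ NumberField.discr K := hdK ▸ hqd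
    have hmultq' : (W.quadraticTwist (((-1 : ℤ) ^ (q / 2) * q : ℤ) : ℚ)).HasMultiplicativeReductionAtPrime q := by
      have h := hmultq; rw [primeStar_eq] at h; exact h
    obtain ⟨hWdmult, hWdns⟩ := TwistRootNumberTwisted.quadraticTwist_discr_nonsplit_at_of_nonsplitClass W hq2 hmultq'
      K hKiq hqd' hclass Wd ⟨Cd⁻¹, by rw [← hdK, ← hCd, inv_smul_smul]⟩
    -- `V^{(D)} ≅ Wd^{(u)}`, `u = p* ℓ₀*`
    obtain ⟨u, hu⟩ : ∃ u : ℤ, u = ps * ls := ⟨_, rfl⟩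
    have hu0 : u ≠ 0 := by rw [hu]; exact mul_ne_zero hps0 hls0
    have huQ : ((u : ℤ) : ℚ) ≠ 0 := by exact_mod_cast hu0
    have hpsQ : ((ps : ℤ) : ℚ) = (-1 : ℚ) ^ (p / 2) * p := by rw [hps]; push_cast; ring
    have hCV' : CV • V = W.quadraticTwist ((ps : ℤ) : ℚ) := by rw [hpsQ]; exact hCV
    obtain ⟨C₁, hC₁⟩ :=
      P2.SplitBadTwistTypes.exists_smul_quadraticTwist_eq_of_smul_eq_quadraticTwist hCV' ((D : ℤ) : ℚ)
    -- `E^{(p* D)} = (E^{(d_K)})^{(u)} = (Cd • Wd)^{(u)}`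
    have e1 : W.quadraticTwist ((ps : ℚ) * (D : ℚ)) =
        (⟨Cd.u, ((u : ℤ) : ℚ) * Cd.r, 0, 0⟩ : VariableChange ℚ) • Wd.quadraticTwist ((u : ℤ) : ℚ) := by
      have : (ps : ℚ) * (D : ℚ) = (dK : ℚ) * ((u : ℤ) : ℚ) := by rw [hD, hu]; push_cast; ring
      rw [this, ← quadraticTwist_quadraticTwist, ← hCd, WeierstrassCurve.quadraticTwist_smul]
    rw [e1] at hC₁
    -- `V^{(D)} = C₁⁻¹ • C₃ • Wd^{(u)}`
    have hVD : V.quadraticTwist (D : ℚ) =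
        C₁⁻¹ • ((⟨Cd.u, ((u : ℤ) : ℚ) * Cd.r, 0, 0⟩ : VariableChange ℚ) • Wd.quadraticTwist ((u : ℤ) : ℚ)) := by
      rw [← hC₁, inv_smul_smul]
    haveI := Wd.isElliptic_quadraticTwist huQ
    rw [hVD, hasSplitMultiplicativeReductionAtPrime_smul_iff, hasSplitMultiplicativeReductionAtPrime_smul_iff]
    -- at the place `w` over `q`: unit twist by the square class `u`
    obtain ⟨w, hw'⟩ : ∃ w : HeightOneSpectrum (𝓞 ℚ), (primesEquiv w : ℕ) = q :=
      ⟨(primesEquiv (R := 𝓞 ℚ)).symm ⟨q, hq.out⟩, by simp⟩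
    have hw2 : (primesEquiv w : ℕ) ≠ 2 := by rw [hw']; exact hq2
    have hwu : ¬ ((primesEquiv w : ℕ) : ℤ) ∣ u := by
      rw [hw', hu]
      intro h
      rcases Int.Prime.dvd_mul' hq.out h with h | h
      · exact hqp (eq_of_prime_dvd_pStar (p := p) hq.out h)
      · exact hqls h
    have hWdmult_w : Wd.HasMultiplicativeReductionAt w := by
      rw [← Wd.hasMultiplicativeReductionAtPrime_iff_hasMultiplicativeReductionAt_ringOfIntegers w]
      subst hw'; exact hWdmult
    obtain ⟨-, -, key⟩ :=
      AdditivePotMult.hasMultiplicativeReductionAt_and_split_iff_quadraticTwist_of_not_dvd Wd w hw2 hwu hWdmult_w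
    have e2 : (Wd.quadraticTwist ((u : ℤ) : ℚ)).HasSplitMultiplicativeReductionAt w ↔
        (Wd.quadraticTwist ((u : ℤ) : ℚ)).HasSplitMultiplicativeReductionAtPrime q := by
      rw [← (Wd.quadraticTwist ((u : ℤ) : ℚ)).hasSplitMultiplicativeReductionAtPrime_iff_hasSplitMultiplicativeReductionAt w]
      subst hw'; rfl
    have e3 : Wd.HasSplitMultiplicativeReductionAt w ↔ Wd.HasSplitMultiplicativeReductionAtPrime q := by
      rw [← Wd.hasSplitMultiplicativeReductionAtPrime_iff_hasSplitMultiplicativeReductionAt w]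
      subst hw'; rfl
    have hsq : IsSquare ((u : ℤ) : ZMod (primesEquiv w : ℕ)) := by
      rw [hw']
      refine ZMod.isSquare_of_jacobiSym_eq_one ?_
      have hJq : J(ls | q) = J(ps | q) := hJls q hq.out (hqN.trans hNM) hq2 hqp
      rw [hu, jacobiSym.mul_left, hJq]
      exact jacobiSym_mul_self_eq_one hq.out (fun hd ↦ hqp (eq_of_prime_dvd_pStar (p := p) hq.out hd))
    rw [← e2, key, e3]
    intro h
    exact hWdns (h.mp hsq)
  -- §f the engine on `V`
  have hroot := TwistRootNumberTwisted.rootNumber_quadraticTwist_eq_of_potMult_kronecker_anyTwo V hmod httV h2ttV hq2 haddVq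
    hmultVq hDm hD4 hTsq hqT hgoodV hnsD
  -- §g the reciprocity identity: the engine's product is `(N_V/p)`
  have hf : ∀ r ∈ (V.conductorNorm ℤ).primeFactors,
      (V.conductorNorm ℤ).factorization r = 1 ∨ Even ((V.conductorNorm ℤ).factorization r) := by
    intro r hr
    obtain ⟨hrP, hrN, -⟩ := Nat.mem_primeFactors.mp hr
    set R : Nat.Primes := ⟨r, hrP⟩ with hR
    haveI := Fact.mk hrP
    rcases V.hasGoodReductionAt_or_hasMultiplicativeReductionAt_or_hasAdditiveReductionAt
      ((primesEquiv (R := ℤ)).symm R) with hg | hm | ha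
    · exfalso
      have hg' := ((V.hasGoodReductionAtPrime_iff_hasGoodReductionAt_holds) R).mpr hg
      exact ((V.dvd_conductorNorm_iff_not_hasGoodReductionAtPrime r).mp hrN) hg'
    · left
      have hm' := ((V.hasMultiplicativeReductionAtPrime_iff_hasMultiplicativeReductionAt_holds) R).mpr hm
      exact (AdditiveKoly.hasMultiplicativeReductionAtPrime_iff_factorization_conductorNorm_eq_one V r).mp hm'
    · right
      by_cases hr2 : r = 2
      · -- additive twist-type `2`: `f₂(V) ∈ {4, 6}` is even
        have hRP : R = ⟨2, Nat.prime_two⟩ := Subtype.ext hr2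
        rw [hRP] at ha
        obtain ⟨t, ht, hnt⟩ := h2ttV ⟨2, Nat.prime_two⟩ rfl ha
        have hev := TwistRootNumberTwisted.even_conductorExponent_two_of_twistType_two V ht hnt
        rw [← factorization_conductorNorm_primesEquiv_symm V ⟨2, Nat.prime_two⟩] at hev
        rw [hr2]; exact hev
      have hf2 := TwistTypeConductor.conductorExponent_eq_two_of_twistType_odd V R hr2 ha (fun _ ↦ httV R hr2 ha)
      rw [← factorization_conductorNorm_primesEquiv_symm V R] at hf2
      exact ⟨1, by rw [hf2]⟩
  have hfq : (V.conductorNorm ℤ).factorization q ≠ 1 := by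
    have h2le := (two_le_conductorExponent_iff_holds ((primesEquiv (R := ℤ)).symm ⟨q, hq.out⟩) V).mpr haddVq
    rw [← factorization_conductorNorm_primesEquiv_symm V ⟨q, hq.out⟩] at h2le
    simp only at h2le
    omega
  have hDr : ∀ r ∈ (V.conductorNorm ℤ).primeFactors, r ≠ 2 → r ≠ q → (V.conductorNorm ℤ).factorization r = 1 →
      J(D | r) = J(((-1 : ℤ) ^ (p / 2) * p) | r) := by
    intro r hr hr2 hrq _
    obtain ⟨hrP, hrN, -⟩ := Nat.mem_primeFactors.mp hr
    have hrW : r ∣ W.conductorNorm ℤ := hrN.trans hNVW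
    have hrp : r ≠ p := by rintro rfl; exact hpNV hrN
    have hdKr : J(dK | r) = 1 := by
      rw [hdK]; exact (Quadratic.ncard_primesOver_eq_two_iff_jacobiSym hKiq.1 hrP hr2).mp (hsplit r hrP hrW hrq)
    rw [hD, jacobiSym.mul_left, hdKr, hJls r hrP (hrW.trans hNM) hr2 hrp, one_mul]
  have hD2 : 2 ∈ (V.conductorNorm ℤ).primeFactors → (V.conductorNorm ℤ).factorization 2 = 1 →
      ZMod.χ₈ (D : ZMod 8) = J(2 | p) := by
    intro _ _
    -- `χ₈(D) = χ₈(d_K) χ₈(ℓ₀*) = χ₈(ℓ₀*) = χ₈(p*) = (2/p)` from `d_K ≡ 1`, `p* ℓ₀* ≡ 1 (mod 8)`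
    have e1 : ZMod.χ₈ ((ps * ls : ℤ) : ZMod 8) = 1 := by
      rw [ZMod.χ₈_int_eq_if_mod_eight]; simp only [show (ps * ls) % 2 ≠ 0 by omega, if_false, hpsls, true_or, if_true]
    have e2 : ZMod.χ₈ ((dK : ℤ) : ZMod 8) = 1 := by
      rw [ZMod.χ₈_int_eq_if_mod_eight]; simp only [show dK % 2 ≠ 0 by omega, if_false, hdK8, true_or, if_true]
    have e3 : ZMod.χ₈ ((ps : ℤ) : ZMod 8) = J(2 | p) := χ₈_intCast_eq_jacobiSym_two_of_emod_eight hp.out hp2 (by rw [hps])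
    have e4 : ZMod.χ₈ ((ps : ℤ) : ZMod 8) * ZMod.χ₈ ((ls : ℤ) : ZMod 8) = 1 := by rw [← map_mul, ← Int.cast_mul, e1]
    have e5 : ZMod.χ₈ ((ps : ℤ) : ZMod 8) = 1 ∨ ZMod.χ₈ ((ps : ℤ) : ZMod 8) = -1 := by
      rw [ZMod.χ₈_int_eq_if_mod_eight]; simp only [show ps % 2 ≠ 0 by omega, if_false]; split_ifs <;> simp
    rw [hD, Int.cast_mul, map_mul, e2, one_mul, ← e3]
    rcases e5 with h | h <;> rw [h] at e4 ⊢ <;> linarith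
  have hPi := prod_engineKronecker_eq_jacobiSym_even (D := D) hp.out hp2 hNV0 hpNV hf hfq hDr hD2
  have hχ : ZMod.χ₄ (D.natAbs : ZMod 4) = - J(-1 | p) := by
    rw [hD, hls]
    exact χ₄_natAbs_discr_mul_eq hp.out hp2 hℓ₀ hdKneg hdK4 hls4' hσp
  rw [hPi, hχ] at hroot
  -- §h the globally minimal model `X` and its root number
  obtain ⟨X, iX, iXm, CX, hCX⟩ := exists_isGloballyMinimal_smul_eq_quadraticTwist V hDQ
  have hXroot : X.rootNumber = -1 := by
    have e : X.rootNumber = (V.quadraticTwist (D : ℚ)).rootNumber := by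
      rw [← hCX]; exact ((X.rootNumber_smul_holds CX)).symm
    rw [e, hroot]
    rw [hrootW] at hw
    linear_combination (-1 : ℤ) * hw
  -- §i outputs
  have hpos : 0 < ps * ((-1 : ℤ) ^ (ℓ₀ / 2) * ℓ₀) := by
    have hsq : ((-1 : ℤ) ^ (p / 2)) * ((-1 : ℤ) ^ (p / 2)) = 1 := by
      rcases neg_one_pow_eq_or ℤ (p / 2) with h | h <;> rw [h] <;> norm_num
    rw [hps, hσp, show (-1 : ℤ) ^ (p / 2) * (p : ℤ) * ((-1 : ℤ) ^ (p / 2) * (ℓ₀ : ℤ)) =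
      (((-1 : ℤ) ^ (p / 2)) * ((-1 : ℤ) ^ (p / 2))) * ((p : ℤ) * ℓ₀) by ring, hsq, one_mul]
    exact mul_pos (by exact_mod_cast hp.out.pos) (by exact_mod_cast hℓ₀.pos)
  have h8out : 2 ∣ W.conductorNorm ℤ → (ps * ((-1 : ℤ) ^ (ℓ₀ / 2) * ℓ₀)) % 8 = 1 := fun _ ↦ by rw [← hls]; exact hpsls
  have hJp : J((-1 : ℤ) ^ (ℓ₀ / 2) * ℓ₀ | p) = 1 := by
    have := hJℓ₀ p ((hScrt_mem p).mpr ⟨hp.out, hpN.trans hNM, hp2⟩)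
    simp only [hη, if_true] at this
    exact this
  have hJdKp : J(dK | p) = 1 := by
    rw [hdK]; exact (Quadratic.ncard_primesOver_eq_two_iff_jacobiSym hKiq.1 hp.out hp2).mp (hsplit p hp.out hpN hpq)
  have hCX' : CX • X = V.quadraticTwist (((dK * ((-1 : ℤ) ^ (ℓ₀ / 2) * ℓ₀) : ℤ)) : ℚ) := by
    rw [← hls, ← hD]; exact hCX
  exact ⟨V, iV, iVm, C', δ, ℓ₀, X, iX, iXm, CX, hC', hordV, hNWV, hfac, hδsq, hpδ, hqδ, hδ0, hℓ₀, hℓ₀p, hℓ₀q, hℓ₀2,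
    hℓ₀NM₀, hℓ₀δ, hpos, h8ℓ₀, h8out, fun r hr hrM hr2 hrp ↦ (hls ▸ hJls r hr (hM ▸ hrM) hr2 hrp), hJp, hJdKp,
    hCX', hXroot⟩

end Aux

end Summit.BirchSwinnertonDyer.BirchSwinnertonDyer.Theorems.TwistedWanRoad

end
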